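import Summits.CriticalPhenomena.Ising3DConformalLimit.Theorems.HyperoctahedralRPExistsScaleCovariantLimitDoublingOfDyadicPairRatio
import Summits.CriticalPhenomena.Ising3DConformalLimit.Theorems.HyperoctahedralRPExistsScaleCovariantLimitCompactnessItemMapsDoubling
import HarnessLib

/-!
# Birth skeleton (BC3) — crux `PointwiseLimit` (item stmt-CriticalPhenomena-6153), route `MirrorHoelderCompactness`

Crux (route `Summits/CriticalPhenomena/Ising3DConformalLimit/Theses/MirrorHoelderCompactness.lean`, rank 5, decl
`Summit.CriticalPhenomena.Ising3DConformalLimit.Theses.MirrorHoelderCompactness.PointwiseLimit`):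
full-filter POINTWISE convergence, as `δ → 0⁺`, of the pinned zoom
`ρ★(δ)ⁿ ⟨∏ σ_{[x_k/δ]}⟩⁺_{β_c(3)}`, `ρ★(δ) = ⟨σ₀σ_{⌊1/δ⌋e₀}⟩^{-1/2}`, at every non-coincident configuration `x`.
Registrar: `planner-skel-stmt-CriticalPhenomena-6153-0` (skeleton-register, 2026-08-17); line card `Lines/birth.md`.

## Standing knowledge used (all landed, sorry-free)
* `TwoHierarchies.crux_iff_pointwiseLimit` (p123864): **this crux ⟺ item 1981 `HyperoctahedralRP.ExistsScaleCovariantLimit`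
  EXACTLY** — so the Disproof work file of crux 1981 (`Cruxes/ExistsScaleCovariantLimit/Disproof.lean`, v8) applies verbatim:
  §H crux ⟺ TIGHTNESS ∧ UNIQUENESS of the pinned cluster point; §E the discretely self-similar family `W_ε` is tight with TWO
  cluster points (uniqueness is where the Ising-specific input is consumed); §K tightness alone already forces axis doubling.
  No `_false_without_` theorem and no §F target exists for this crux; no stub below is an instance of a landed `Negative/` lemma.
* `TwoHierarchies.twoPointDoubling_of_pointwiseLimit` (p123864): **this crux ⟹ item 6150 `TwoPointDoubling`** (rank-2 crux of the
  SAME route) — `PointwiseLimit` is not independent of the route's compactness input; and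
  `TwoHierarchies.ItemMaps.orbitPrecompact_iff_doubling` (p120504): 6150 ⟺ item 5955 `MonotoneRG.OrbitPrecompact` (tightness).
* `ExistsScaleCovariantLimitNegative.crux_iff_orbitPrecompact_and_unique` (p78620): 1981 ⟺ 5955 ∧ [cluster point unique].

## Shape: PointwiseLimit ⟺ (T) ∧ (U) — two registered stubs, each STRICTLY WEAKER than the crux, jointly equal to it
* (T) `stub_twoPointDoubling` — the TIGHTNESS half in its one-scalar lattice form: all-scale axis doubling `κ·g(n) ≤ g(2n)` of the
  critical two-point function on `ℤ³` (verbatim item 6150 = Aizenman–Duminil-Copin 2021 Remark 5.10, OPEN; by the funnel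
  p131624 every existence engine on record passes through it). Not the crux: `W_ε` satisfies (T) and has no limit (Disproof §E).
* (U) `stub_clusterPointUnique` — the UNIQUENESS half: any two locally-uniform cluster points of the pinned zoom agree off the
  diagonals (verbatim the body of `FoldedCurrentRepulsion.ClusterPointUnique`, the split child recommended by the crux-1981
  strategist census `Cruxes/ExistsScaleCovariantLimit/STRATEGY-CENSUS.md` §Decomposition). Not the crux and NOT funnelled into 6150:
  it quantifies over locally-uniform cluster points only, so it is silent (vacuous) along scales where tightness fails; it is the
  identification problem (Duminil-Copin ICM 2022 §8.4) that this route's thesis assigns to "compactness + identification" lines.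
* `PointwiseLimit_of : (T) → (U) → PointwiseLimit` — kernel-checked composition through the three landed equivalences above, its
  hypotheses being the stub statements BY NAME (`__Registered.stub_*`, `abbrev`s repeating the registered signatures verbatim — the
  form `#h21_check_skeleton` admits; device shared with the sibling birth skeletons `Cruxes/BallSpecifiedFieldLimit/Lines/birth.lean`,
  `Cruxes/PinningEfficiencyDeficit/Lines/birth.lean`); the closing `example` feeds it the registered stubs;
  `stubs_of_PointwiseLimit` — the converse (both stubs are CONSEQUENCES of the crux, landed), certifying that the decomposition is
  exact: `PointwiseLimit ⟺ (T) ∧ (U)`.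

Sorries: exactly two, inside `stub_twoPointDoubling` and `stub_clusterPointUnique`; zero elsewhere.
-/

noncomputable section

namespace Summit.CriticalPhenomena.Ising3DConformalLimit.Cruxes.PointwiseLimit.Birth

open Literature.Probability.LatticeModels Filter Set
open scoped Topology
open Summit.CriticalPhenomena.Ising3DConformalLimit.MoebiusLimitExistsOnlyInteraction (rhoPin IsClusterPoint)
open Summit.CriticalPhenomena.Ising3DConformalLimit.Theses
open Summit.CriticalPhenomena.Ising3DConformalLimit.Cruxes.ExistsScaleCovariantLimit

/-! ## Registered stubs -/

/-- **(T) TIGHTNESS HALF — all-scale axis doubling of the critical two-point function on `ℤ³`** (verbatim item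
stmt-CriticalPhenomena-6150 `MirrorHoelderCompactness.TwoPointDoubling`; ⟺ item 5955 `OrbitPrecompact` ⟺ item 4658
`UniformRegularity`, p120504). OPEN: Aizenman–Duminil-Copin, Ann. Math. 194 (2021), arXiv:1912.07973, Remark 5.10 (regular scales
only in abundance, Thm 5.12). Size: open problem (a live line on it: `folded-current-repulsion` of crux 1981).
[cite: AizenmanDuminilCopinAnnals2021, Remark 5.10] -/
theorem stub_twoPointDoubling :
    ∃ κ : ℝ, 0 < κ ∧ ∀ n : ℕ, 1 ≤ n →
      κ * criticalTwoPoint 3 (Pi.single 0 (n : ℤ)) ≤ criticalTwoPoint 3 (Pi.single 0 (2 * (n : ℤ))) := by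
  sorry

/-- **(U) UNIQUENESS HALF — the pinned zoom has at most one locally-uniform cluster point** (verbatim the body of
`FoldedCurrentRepulsion.ClusterPointUnique`; `IsClusterPoint S` = along some mesh sequence `u_k → 0⁺` the `ρ_pin`-rescaled critical
correlators converge to `S n` locally uniformly on `NonCoincident 3 n` for every `n`). OPEN: the identification half of the
existence of the 3D Ising scaling limit (Duminil-Copin, ICM 2022, §8.4). Size: open problem (the hardest stub).
[cite: DuminilCopinICM2022, §8.4] -/
theorem stub_clusterPointUnique :
    ∀ S S' : CorrFamily 3, IsClusterPoint S → IsClusterPoint S' → ∀ n, Set.EqOn (S n) (S' n) (NonCoincident 3 n) := by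
  sorry

/-! ### The two stub statements BY NAME — the hypotheses of `PointwiseLimit_of`

The native skeleton audit (`#h21_check_skeleton`, run by `ledger skeleton check`) admits a hypothesis of the composing theorem
only if its head constant is a registered obligation or is NAMED like a declared stub; so each registered stub
`stub_X : <signature> := by sorry` above is mirrored by the alias `abbrev __Registered.stub_X : Prop := <the same signature,
verbatim>` and `PointwiseLimit_of` is stated over the two aliases (the gate-reserved `@[stub]` attribute is not written by a
planner). Each alias is an `abbrev`, definitionally its statement. -/
namespace __Registered

/-- Alias of the statement of the registered stub `stub_twoPointDoubling` (T), keyed by its name. -/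
abbrev stub_twoPointDoubling : Prop :=
  ∃ κ : ℝ, 0 < κ ∧ ∀ n : ℕ, 1 ≤ n →
    κ * criticalTwoPoint 3 (Pi.single 0 (n : ℤ)) ≤ criticalTwoPoint 3 (Pi.single 0 (2 * (n : ℤ)))

/-- Alias of the statement of the registered stub `stub_clusterPointUnique` (U), keyed by its name. -/
abbrev stub_clusterPointUnique : Prop :=
  ∀ S S' : CorrFamily 3, IsClusterPoint S → IsClusterPoint S' → ∀ n, Set.EqOn (S n) (S' n) (NonCoincident 3 n)

end __Registered

/-! ## Composition — the crux BY NAME -/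

/-- **COMPOSITION** (kernel-checked, sorry-free). `(T) → (U) → MirrorHoelderCompactness.PointwiseLimit`: doubling is
precompactness of the zoom orbit (`ItemMaps.orbitPrecompact_iff_doubling`), precompactness + uniqueness of the cluster point is the
existence crux 1981 (`crux_iff_orbitPrecompact_and_unique`), and crux 1981 gives full-filter pointwise convergence of the pinned
zoom with `ρ★ = ρ_pin` (`pointwiseLimit_of_existsScaleCovariantLimit`). Hypotheses = the stub statements by name
(`__Registered.stub_*`), conclusion = the crux by name. -/
theorem PointwiseLimit_of :
    __Registered.stub_twoPointDoubling → __Registered.stub_clusterPointUnique →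
      Summit.CriticalPhenomena.Ising3DConformalLimit.Theses.MirrorHoelderCompactness.PointwiseLimit := by
  intro hT hU
  dsimp only [__Registered.stub_twoPointDoubling, __Registered.stub_clusterPointUnique] at hT hU
  have hD : MirrorHoelderCompactness.TwoPointDoubling := hT
  exact TwoHierarchies.pointwiseLimit_of_existsScaleCovariantLimit
    (ExistsScaleCovariantLimitNegative.crux_iff_orbitPrecompact_and_unique.2
      ⟨TwoHierarchies.ItemMaps.orbitPrecompact_iff_doubling.2 hD, hU⟩)

/-- The crux from the registered stubs — closed modulo exactly `stub_twoPointDoubling`, `stub_clusterPointUnique`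
(kernel-checked `example`, deliberately NOT a named declaration: it depends on the stubs' `sorry`s until they land). -/
example : Summit.CriticalPhenomena.Ising3DConformalLimit.Theses.MirrorHoelderCompactness.PointwiseLimit :=
  PointwiseLimit_of stub_twoPointDoubling stub_clusterPointUnique

/-- **EXACTNESS of the decomposition** (sorry-free): the crux implies BOTH stub statements
(`twoPointDoubling_of_pointwiseLimit`, `clusterPoint_eqOn_of_pointwiseLimit`, landed), so `PointwiseLimit ⟺ (T) ∧ (U)`:
each stub is necessary, neither is sufficient (BC3 probes, `Lines/birth.md`), neither can be weakened away. -/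
theorem stubs_of_PointwiseLimit
    (h : Summit.CriticalPhenomena.Ising3DConformalLimit.Theses.MirrorHoelderCompactness.PointwiseLimit) :
    __Registered.stub_twoPointDoubling ∧ __Registered.stub_clusterPointUnique :=
  ⟨TwoHierarchies.twoPointDoubling_of_pointwiseLimit h,
    fun S S' hS hS' n => TwoHierarchies.clusterPoint_eqOn_of_pointwiseLimit h S S' hS hS' n⟩

/-- The decomposition as one `Iff` (sorry-free). -/
theorem PointwiseLimit_iff_stubs :
    Summit.CriticalPhenomena.Ising3DConformalLimit.Theses.MirrorHoelderCompactness.PointwiseLimit ↔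
      (__Registered.stub_twoPointDoubling ∧ __Registered.stub_clusterPointUnique) :=
  ⟨stubs_of_PointwiseLimit, fun h => PointwiseLimit_of h.1 h.2⟩

end Summit.CriticalPhenomena.Ising3DConformalLimit.Cruxes.PointwiseLimit.Birth

end
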